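/-
Cell pub-hodgecm2 (COR-CM = stage 2 of the Hodge ladder), seat p2 (binder prover 2/8), gen 22
(prover-pub-hodgecm2-p2-g22-0), 2026-08-21.  Count-neutral own lane PERL-WEIL-LINE (work item W-a of
`hodge-director/B01-SIZE.md` §4 T2), file F5: the classes `PerL` makes algebraic are EXOTIC (not products of divisor
classes).  Theorems only; HC_CM is NOT proved; `PerL` consumed BY NAME.
T5: the only hypothesis binders of Literature/conjecture type are `hP : U_rec.PerL` (resp. the four universe records,
all tree theorems, + `hP`) — joint inhabitation = PerL(U_rec), the cell's standing hypothesis; no contradiction derived.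
-/
import Summits.HodgeConjecture.CorCM.PerLWeilLineClassesAnyRealisation
import Summits.HodgeConjecture.CorCM.WeilLineClassesWeilWeightLines
import Summits.HodgeConjecture.CorCM.CyclicSexticFaces
import HarnessLib

/-!
# The Weil-line classes of the PerL corner product are EXOTIC Hodge classes — so `PerL` certifies the
# algebraicity of a non-zero space of exceptional `(2,2)`-classes

For a sextic CM field `K`, a frame `φ` and a PerL quadruple `t` (sign table `perlSign`: all four types contain
`φ 0`, and they are pairwise distinct, `StubTree.injective_of_isPerLTypes`), the corner quadruple
`Φ = (t⁰, t̄², t̄³, t¹)` has slot count `#{j | s ∈ Φ_j} = 2` for every `s` (pair-sum identity,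
`StubTree.pairSum_of_isPerLTypes` + `sumTwo_quad_of_pairSum` + `CyclicSextic.sumTwo_iff_ncard_eq_two`) and is NOT a
union of conjugate pairs: the type `t⁰` occurs once among the `Φ_j` and its conjugate `t̄⁰` never
(`typeCount_perLCorner_ne`).  By the tree's dichotomy for Deligne's Weil space
(`WeilLineWeightLines.weilLineClasses_exotic`, Deligne 1982 §5 (c), Gordon 9.2.2) the `K`-Weil-line space `W` of
ANY realisation family `(A_i, act_i, θ_i)` of the corner types is therefore a NON-ZERO subspace of `B²(⨁ A) ⊗ ℂ`
meeting the divisor ring `D²(⨁ A) ⊗ ℂ` TRIVIALLY (`weilLineClasses_perLCorner_exotic`): its classes are exceptional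
Hodge classes in the sense of Weil 1977 / Pohlmann.  Combined with the realisation-free consumer of `PerL`
(`Model.weilLineClasses_le_algebraicClasses_of_perL_rec_of_isCMTypeRealisation`, `CorCM/PerLWeilLineClassesAnyRealisation.lean`):

* **`Model.perL_rec_weilLine_exotic_and_algebraic`** — `PerL(U_rec)` ⟹ for every stage-1 configuration and ANY
  realisations of the corner types, `W ≠ 0`, `W ≤ B² ⊗ ℂ`, `W ∩ (D² ⊗ ℂ) = 0` AND `W ≤ algebraicClasses`:
  the stage-1 statement proves the algebraicity of genuinely exceptional Hodge classes on 12-dimensional CM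
  abelian varieties (one 6-dimensional space per configuration) — and nothing more is claimed (NOT HC_CM).

References: Deligne LNM 900 §5 (c); B. B. Gordon, *A survey of the Hodge conjecture for abelian varieties* 9.2.2;
Pohlmann 1968; Weil 1977; `hodge-director/B01-SIZE.md` §3–§4.
-/

noncomputable section

open CategoryTheory CategoryTheory.Limits NumberField
open Literature.AlgebraicGeometry.Motives Literature.AlgebraicGeometry.HodgeTheory
open Literature.AlgebraicGeometry.ComplexMultiplication Literature.NumberTheory.Automorphic
open Literature.AlgebraicGeometry.Deligne1982 (typeCount)
open Literature.AlgebraicGeometry.VanGeemen1994 (hodgeClassSpan)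
open Literature.Barriers.HodgeConjecture (divisorClassesSpan)
open Literature.NumberTheory.ComplexMultiplication.CMTypeOps (bar mem_bar_iff)

namespace Summit.HodgeConjecture.CorCM.Model

/-! ## §1 Combinatorics of the PerL corner quadruple -/

/-- All four PerL types contain the first frame embedding `φ 0` (first column of the sign table is `+`). [folklore] -/
theorem mem_of_isPerLTypes_zero {K : CMField} {φ : Fin 3 → (K →+* ℂ)} {t : Fin 4 → CMType K}
    (ht : IsPerLTypes φ t) (i : Fin 4) : φ 0 ∈ (t i).1 :=
  (ht i 0).2 (by fin_cases i <;> rfl)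

/-- **The PerL corner quadruple is not a union of conjugate pairs**: the type `t⁰` occurs among
`(t⁰, t̄², t̄³, t¹)` but its conjugate does not (`φ 0` lies in every `tⁱ`, the `tⁱ` are pairwise distinct), so
Deligne's multiplicities differ: `d(t⁰) ≠ d(t̄⁰)`. [folklore] -/
theorem typeCount_perLCorner_ne (K : CMField) (φ : Fin 3 → (K →+* ℂ)) (hφ : IsFrame φ) (t : Fin 4 → CMType K)
    (ht : IsPerLTypes φ t) :
    ∃ S : Set (K →+* ℂ),
      typeCount (m := 2) (![t 0, bar (t 2), bar (t 3), t 1] : Fin (2 * 2) → CMType K) S ≠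
        typeCount (m := 2) (![t 0, bar (t 2), bar (t 3), t 1] : Fin (2 * 2) → CMType K) Sᶜ := by
  have hinj := StubTree.injective_of_isPerLTypes K φ hφ t ht
  have h0 : ∀ i, φ 0 ∈ (t i).1 := mem_of_isPerLTypes_zero ht
  refine ⟨(t 0).1, ?_⟩
  have hpos : typeCount (m := 2) (![t 0, bar (t 2), bar (t 3), t 1] : Fin (2 * 2) → CMType K) (t 0).1 ≠ 0 := by
    unfold typeCount
    rw [← Nat.pos_iff_ne_zero, Set.ncard_pos]
    exact ⟨0, rfl⟩
  have hzero : typeCount (m := 2) (![t 0, bar (t 2), bar (t 3), t 1] : Fin (2 * 2) → CMType K) (t 0).1ᶜ = 0 := by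
    unfold typeCount
    rw [Set.ncard_eq_zero, Set.eq_empty_iff_forall_notMem]
    intro j hj
    change ((![t 0, bar (t 2), bar (t 3), t 1] : Fin 4 → CMType K) j).1 = (t 0).1ᶜ at hj
    have hc : ∀ i, (t i).1 ≠ (t 0).1ᶜ := fun i h =>
      (show φ 0 ∈ (t 0).1ᶜ from h ▸ h0 i) (h0 0)
    have hb : ∀ i, i ≠ 0 → (bar (t i)).1 ≠ (t 0).1ᶜ := fun i hi h =>
      hi (hinj (Subtype.ext (compl_injective (show (t i).1ᶜ = (t 0).1ᶜ from h))))
    fin_cases j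
    · exact hc 0 hj
    · exact hb 2 (by decide) hj
    · exact hb 3 (by decide) hj
    · exact hc 1 hj
  rw [hzero]
  exact hpos

/-- The PerL corner quadruple has slot count `#{j | s ∈ Φ_j} = 2` for every embedding `s` (pair-sum identity).
[folklore] -/
theorem ncard_perLCorner_eq_two (K : CMField) (φ : Fin 3 → (K →+* ℂ)) (hφ : IsFrame φ)
    (h6 : Module.finrank ℚ K = 6) (t : Fin 4 → CMType K) (ht : IsPerLTypes φ t) (s : K →+* ℂ) :
    {j : Fin 4 | s ∈ ((![t 0, bar (t 2), bar (t 3), t 1] : Fin 4 → CMType K) j).1}.ncard = 2 :=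
  (CyclicSextic.sumTwo_iff_ncard_eq_two _).1
    (sumTwo_quad_of_pairSum (StubTree.pairSum_of_isPerLTypes K φ hφ h6 t ht)) s

/-! ## §2 The Weil space of any realisation family of the corner types is exotic -/

/-- **The `K`-Weil-line space of a PerL corner family is EXOTIC.**  For ANY realisations `(A_i, act_i, θ_i)` of
the corner types `(t⁰, t̄², t̄³, t¹)` of a PerL quadruple of a sextic CM field: `W = weilLineClasses A act 4` is
non-zero, lies in `B²(⨁ A) ⊗ ℂ` (span of rational `(2,2)` classes) and meets `D²(⨁ A) ⊗ ℂ` (span of products of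
two rational `(1,1)` classes) trivially — the tree's dichotomy `WeilLineWeightLines.weilLineClasses_exotic` fed
with `ncard_perLCorner_eq_two` and `typeCount_perLCorner_ne`.
[cite: Deligne1982HodgeCycles, I §5 (c) (pp. 38–39)] [cite: Gordon1999HodgeAVSurvey, 9.2.2 and §9.3] -/
theorem weilLineClasses_perLCorner_exotic (K : CMField) (φ : Fin 3 → (K →+* ℂ)) (hφ : IsFrame φ)
    (h6 : Module.finrank ℚ K = 6) (t : Fin 4 → CMType K) (ht : IsPerLTypes φ t)
    {A : Fin 4 → AbelianVariety ℂ} {act : ∀ i, 𝓞 K →+* End (A i)}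
    {θ : ∀ i, (K : Type) →+* Module.End ℂ (complexBetti (A i).X 1)}
    (hA : ∀ i, IsCMTypeRealisation ((![t 0, bar (t 2), bar (t 3), t 1] : Fin 4 → CMType K) i) (A i) (act i)
      (θ i)) :
    weilLineClasses A act 4 ≠ ⊥ ∧
      weilLineClasses A act 4 ≤ hodgeClassSpan (⨁ A).dim (⨁ A).X 2 ∧
      Disjoint (weilLineClasses A act 4) (divisorClassesSpan (⨁ A).X (⨁ A).dim 2) :=
  WeilLineWeightLines.weilLineClasses_exotic (m := 2) hA (ncard_perLCorner_eq_two K φ hφ h6 t ht)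
    (typeCount_perLCorner_ne K φ hφ t ht)

/-! ## §3 What `PerL` certifies, stated with the exoticity -/

/-- **`PerL(U_rec)` proves the algebraicity of a non-zero space of EXOTIC `(2,2)` Hodge classes.**  On the model
universe of record, `PerL` implies: for every sextic CM field `K` with normal closure of degree `24` or `48`, frame
`φ`, `ι₁`, PerL quadruple `t`, and ANY realisations `(A_i, act_i, θ_i)` of the corner types `(t⁰, t̄², t̄³, t¹)`
(four CM abelian threefolds), the `K`-Weil-line space `W ⊂ H⁴((⨁ A_i)(ℂ); ℂ)` (of dimension `[K:ℚ] = 6`) is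
non-zero, consists of Hodge classes, contains NO non-zero combination of products of divisor classes, and consists
of ALGEBRAIC classes.  This is the honest Hodge-theoretic yield of stage 1's statement (B01-SIZE §4 T2, W-a); it is
NOT HC_CM and not a case of `PerLFace`. [cite: Deligne1982HodgeCycles, I §5 (c) (pp. 38–39)]
[cite: Gordon1999HodgeAVSurvey, 9.2.2 and §9.3] -/
theorem perL_rec_weilLine_exotic_and_algebraic
    (hP : (picardCMUniverse exists_isReal_hodgeModel_holds hodgePQ_independent_of_hodgeModel_holds
      BallQuotient.ballQuotientUniformised_holds cmAbelianVarietyRealised_holds).PerL)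
    (K L : CMField) (j : K →+* L) (hN : IsNormalClosure ℚ K L) (h6 : Module.finrank ℚ K = 6)
    (hL : Module.finrank ℚ L = 24 ∨ Module.finrank ℚ L = 48)
    (φ : Fin 3 → (K →+* ℂ)) (hφ : IsFrame φ) (ι₁ : L →+* ℂ) (hι : ι₁.comp j = φ 0)
    (t : Fin 4 → CMType K) (ht : IsPerLTypes φ t)
    {A : Fin 4 → AbelianVariety ℂ} {act : ∀ i, 𝓞 K →+* End (A i)}
    {θ : ∀ i, (K : Type) →+* Module.End ℂ (complexBetti (A i).X 1)}
    (hA : ∀ i, IsCMTypeRealisation ((![t 0, bar (t 2), bar (t 3), t 1] : Fin 4 → CMType K) i) (A i) (act i)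
      (θ i)) :
    weilLineClasses A act 4 ≠ ⊥ ∧
      weilLineClasses A act 4 ≤ hodgeClassSpan (⨁ A).dim (⨁ A).X 2 ∧
      Disjoint (weilLineClasses A act 4) (divisorClassesSpan (⨁ A).X (⨁ A).dim 2) ∧
      weilLineClasses A act 4 ≤ algebraicClasses (⨁ A).X 2 :=
  let h := weilLineClasses_perLCorner_exotic K φ hφ h6 t ht hA
  ⟨h.1, h.2.1, h.2.2,
    weilLineClasses_le_algebraicClasses_of_perL_rec_of_isCMTypeRealisation hP K L j hN h6 hL φ hφ ι₁ hι t ht hA⟩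

/-- The same on any instance `U = Model.universeOf hHD hI hU h₃` of the model universe. [cite: Deligne1982HodgeCycles, I §5 (c) (pp. 38–39)] -/
theorem perL_weilLine_exotic_and_algebraic (hHD : exists_isReal_hodgeModel)
    (hI : hodgePQ_independent_of_hodgeModel) (hU : PicardCM.BallQuotientUniformisedDatum)
    (h₃ : PicardCM.CMAbelianVarietyRealised) (hP : (universeOf hHD hI hU h₃).PerL)
    (K L : CMField) (j : K →+* L) (hN : IsNormalClosure ℚ K L) (h6 : Module.finrank ℚ K = 6)
    (hL : Module.finrank ℚ L = 24 ∨ Module.finrank ℚ L = 48)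
    (φ : Fin 3 → (K →+* ℂ)) (hφ : IsFrame φ) (ι₁ : L →+* ℂ) (hι : ι₁.comp j = φ 0)
    (t : Fin 4 → CMType K) (ht : IsPerLTypes φ t)
    {A : Fin 4 → AbelianVariety ℂ} {act : ∀ i, 𝓞 K →+* End (A i)}
    {θ : ∀ i, (K : Type) →+* Module.End ℂ (complexBetti (A i).X 1)}
    (hA : ∀ i, IsCMTypeRealisation ((![t 0, bar (t 2), bar (t 3), t 1] : Fin 4 → CMType K) i) (A i) (act i)
      (θ i)) :
    weilLineClasses A act 4 ≠ ⊥ ∧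
      weilLineClasses A act 4 ≤ hodgeClassSpan (⨁ A).dim (⨁ A).X 2 ∧
      Disjoint (weilLineClasses A act 4) (divisorClassesSpan (⨁ A).X (⨁ A).dim 2) ∧
      weilLineClasses A act 4 ≤ algebraicClasses (⨁ A).X 2 :=
  let h := weilLineClasses_perLCorner_exotic K φ hφ h6 t ht hA
  ⟨h.1, h.2.1, h.2.2,
    weilLineClasses_le_algebraicClasses_of_perL_of_isCMTypeRealisation hHD hI hU h₃ hP K L j hN h6 hL φ hφ ι₁ hι
      t ht hA⟩

end Summit.HodgeConjecture.CorCM.Model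

end
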